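import Summits.QuantumFields.YangMills.Theorems.BalabanUVNodesN15KingModelBoxImagesPrinted
import Summits.QuantumFields.YangMills.Theorems.BalabanUVNodesN15KingModelBoxTransport
import HarnessLib

/-!
# BalabanUVNodes ∕ N15 — THE KING-MODEL RUNG (PART Ε-d): UNIFORM EXPONENTIAL DECAY OF KING's FREE TORUS COVARIANCE AND OF THE FREE-BOUNDARY BOX COVARIANCE,
# WITH EXPLICIT CONSTANTS, ON EVERY TORUS ∕ BOX — `|(lapF K c m²)⁻¹(x,y)| ≤ (2∕m²)·C(κ_F,d)·e^{−(κ_F∕(d+1))·d_T(x,y)}`, `(boxOp n c m²)⁻¹(s,t) ≤ 2^{d+1}·(same)(dbl s, dbl t)`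
# (Track A, DAG node N15 = NE2; FAN-OUT v1.1 §N15 s3 «KING-MODEL RUNG»; the periodisation (Ε-b) turned into an estimate; part Ν-c's transport hypothesis discharged; count-neutral)

HONEST FRAMING.  Count-neutral (cell `pub-ymgap`, seat `pub-ymgap-dag-n15-e` g40; `--supports stmt-QuantumFields-27366 --as helper` = K3⁸).
TEMPLATE LITERATURE: C. King, Commun. Math. Phys. **102** (1986) 649–677 [King1986], (4.4) p.670 (the symbol of `c(−Δ) + m²`), §4 p.670 l.8–13 (transport to `Ω`
through the multiple reflection representation of [Ba 4]); T. Bałaban, Commun. Math. Phys. **95** (1984) 17–40 [Balaban1984PropagatorsI], p.36 l.20–23 («relating G on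
the torus to G on the whole lattice ηZ^d in the usual way») and p.38 (1.126) (uniform exponential decay on the torus); [Balaban1983RegularityDecay] = [Ba 4] (2.42) p.584,
p.586 l.9–15 (the contour shift).  Part Ε-b identified King's torus covariance `(lapF K c m²)⁻¹` with the cell engine's `MultiPeriod.torusKernel` of the free multiplier;
the engine's headline `B4TorusKernel.MultiPeriod.torusKernel_descend_decay_torusMetric` (pv17: decay in the TORUS METRIC, constants uniform in the period vector) therefore
APPLIES, and part Ν-c's transport `kingBoxGreen_le_exp_of_torusDecay` (g39; hypothesis: a torus decay bound `hB`) is DISCHARGED: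
§1 the metric dictionary ★ `tdistT_eq_torusSupNorm` (this lineage's torus distance `King1986.Torus.tdistT K x y` IS pv17's `torusSupNorm K (torRepZ x − torRepZ y)`);
§2 ★★★ **`abs_lapF_inv_le_exp_tdistT`**: for EVERY period vector `K` (all `K_μ ≥ 1`), `c ≥ 0`, `m² > 0`, all `x, y`:
`|(lapF K c m²)⁻¹(x,y)| ≤ (2∕m²)·periodConst κ_F d·e^{−(κ_F∕(d+1))·tdistT K x y}`, `κ_F = kappaFree c m² d` (Ε-a) — uniform in the volume, explicit in `(c, m², d)`;
`lapF_inv_le_exp_tdistT` (without `|·|`); §3 ★★★ **`kingBoxGreen_le_exp`** ∕ ★★★ **`boxOp_inv_le_exp`**: on every box `Ω = Π_μ{0,…,n_μ−1}`,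
`0 ≤ (c(−Δ_free)+m²)⁻¹(s,t) ≤ 2^{d+1}·(2∕m²)·periodConst κ_F d·e^{−(κ_F∕(d+1))·d_Ω(s,t)}` (`d_Ω` = the doubled-torus distance of the embedded points, `≥ |s_μ − t_μ|` in every
direction by part Ν-c) — part Ν-c's `kingBoxGreen_le_exp_of_torusDecay` with its hypothesis supplied by §2; ★★ `norm_imK_freeKer_le` (the same bound for [Ba 4]'s image
series `imK`, by Ε-c).

PRIOR TREE ART (used, not restated): pv17 `B4TorusKernel` (`torusKernel_descend_decay_torusMetric`, `periodConst`, `torusSupNorm`, `circAbs`), `B4Sect5Torus` (`tdist`, `ccoord`,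
`ccoord_cast`), `King1986.UniformDecay` (`tdistT`, `toSite`), parts Ν-a∕Ν-a′∕Ν-c (`kingBoxGreen`, `boxOp_inv_eq_kingBoxGreen`, `kingBoxGreen_nonneg`, `kingBoxGreen_le_exp_of_torusDecay`),
parts Ε-a∕b∕c.  The tree's uniform decay theorems for King's propagators WITH the block term (`King1986.PropagatorDecayUniform.fineOp_inv_decay_unif` etc., `a > 0`, Combes–Thomas)
are a different object and method; here `a = 0` and the method is [Ba 4]'s contour shift + periodisation.  NOT Bałaban's covariant objects; NOT a node discharge (N15 is booked
through n15-a's knit, untouched); nothing continuum-YM ∕ `ℝ⁴` ∕ OS ∕ Clay.  0 `sorry`, 0 `def`.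

HONEST SCOPE.  The constants are crude but honest: in King's fine-lattice units `c = η⁻² = N²` the rate `κ_F∕(d+1) ≈ √(m²∕(4(N²+1)(d+1)))∕(d+1)` per FINE site is `≈ m·η∕(2(d+1)^{3∕2})`,
i.e. a rate `O(m)` per unit of PHYSICAL distance — the correct scaling `e^{−O(m)·dist}`, uniformly in the volume; no claim of optimality (part Ϸ has the sharp rate `m` for the
infinite-volume block field).  Locators: [King1986] (4.4) p.670, §4 p.670 l.8–13; [Balaban1984PropagatorsI] p.36 l.20–23, p.38 (1.126); [Balaban1983RegularityDecay] (2.42) p.584,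
p.586 l.9–15.
-/

noncomputable section

open scoped BigOperators
open Finset Complex Matrix

namespace Summit.QuantumFields.YangMills.BalabanUVNodes.N15KingModelRung.TorusSpectral

open Literature.MathematicalPhysics.QuantumFieldTheory.Balaban1983to89.B5Prop11Plancherel (Tor unitVec)
open Literature.MathematicalPhysics.QuantumFieldTheory.Balaban1983to89.B4TorusKernel (periodConst descendC)
open Literature.MathematicalPhysics.QuantumFieldTheory.Balaban1983to89.B4TorusKernel.MultiPeriod (circAbs circAbs_nonneg torusSupNorm torusKernel_descend_decay_torusMetric)
open Literature.MathematicalPhysics.QuantumFieldTheory.Balaban1983to89.B4Sect5Torus (tdist ccoord ccoord_cast)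
open Literature.MathematicalPhysics.QuantumFieldTheory.Balaban1983to89.B4Reflection242 (box)
open Literature.MathematicalPhysics.QuantumFieldTheory.Balaban1983to89.B4Reflection242.ImageSystem (imK)
open Literature.MathematicalPhysics.QuantumFieldTheory.King1986.Torus

variable {d : ℕ}

/-! ## §1 The metric dictionary: `tdistT` is pv17's `torusSupNorm` of the representative difference -/

section Metric

variable (K : Fin (d + 1) → ℕ) [hK : ∀ μ, NeZero (K μ)]

/-- ★ THE METRIC DICTIONARY: this lineage's torus distance `tdistT K x y = max_μ dist(x_μ − y_μ, K_μℤ)` IS pv17's `torusSupNorm K (torRepZ x − torRepZ y)`. [folklore] -/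
theorem tdistT_eq_torusSupNorm (x y : Tor K) : tdistT K x y = torusSupNorm K (torRepZ K x - torRepZ K y) := by
  have hK1 : ∀ i, 1 ≤ K i := one_le_period K
  unfold tdistT tdist torusSupNorm
  have hcoord : ∀ i, ((ccoord K (toSite K x) (toSite K y) i : ℕ) : ℝ) = ((circAbs (K i) ((torRepZ K x - torRepZ K y) i) : ℤ) : ℝ) := by
    intro i
    rw [show ((ccoord K (toSite K x) (toSite K y) i : ℕ) : ℝ) = (((ccoord K (toSite K x) (toSite K y) i : ℕ) : ℤ) : ℝ) by push_cast; rfl,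
      ccoord_cast hK1]
    rfl
  apply le_antisymm
  · obtain ⟨i, _, hi⟩ := Finset.exists_mem_eq_sup (Finset.univ : Finset (Fin (d + 1))) Finset.univ_nonempty (ccoord K (toSite K x) (toSite K y))
    rw [hi, hcoord i]
    exact Finset.le_sup' (fun i => ((circAbs (K i) ((torRepZ K x - torRepZ K y) i) : ℤ) : ℝ)) (Finset.mem_univ i)
  · refine Finset.sup'_le _ _ fun i _ => ?_
    rw [← hcoord i]
    exact_mod_cast Finset.le_sup (f := ccoord K (toSite K x) (toSite K y)) (Finset.mem_univ i)

end Metric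

/-! ## §2 Uniform exponential decay of King's free torus covariance, explicit constants -/

section TorusDecay

variable (K : Fin (d + 1) → ℕ) [hK : ∀ μ, NeZero (K μ)] {c m2 : ℝ}

/-- ★★★ **UNIFORM DECAY OF KING's FREE TORUS COVARIANCE**: for every period vector `K`, `c ≥ 0`, `m² > 0` and all `x, y ∈ Π_μℤ∕K_μ`,
`|(c(−Δ)+m²)⁻¹(x, y)| ≤ (2∕m²)·periodConst κ_F d·e^{−(κ_F∕(d+1))·tdistT K x y}`, `κ_F = kappaFree c m² d` — [Ba 4]'s contour shift on the infinite lattice (Ε-a) + the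
periodisation (Ε-b) bounded in the torus metric uniformly in the volume (pv17's `torusKernel_descend_decay_torusMetric`). [cite: Balaban1984PropagatorsI, p.38 (1.126), p.36 l.20–23;
Balaban1983RegularityDecay, p.586 l.9–15; King1986, (4.4) p.670] -/
theorem abs_lapF_inv_le_exp_tdistT (hc : 0 ≤ c) (hm : 0 < m2) (x y : Tor K) :
    |(lapF K c m2)⁻¹ x y| ≤ 2 / m2 * periodConst (kappaFree c m2 d) d * Real.exp (-(kappaFree c m2 d / (d + 1) * tdistT K x y)) := by
  have h := torusKernel_descend_decay_torusMetric (stripRegular_freeMultC (d := d) hc hm) (kappaFree_pos hc hm d) (one_le_period K) (torRepZ K x - torRepZ K y)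
  rw [← torusFreeKerC_eq_torusKernel K hc hm, ← lapF_inv_eq_torusFreeKerC K hc hm, Complex.norm_real, Real.norm_eq_abs, ← tdistT_eq_torusSupNorm] at h
  exact h

/-- The same without the absolute value. [cite: Balaban1984PropagatorsI, p.38 (1.126); King1986, (4.4) p.670] -/
theorem lapF_inv_le_exp_tdistT (hc : 0 ≤ c) (hm : 0 < m2) (x y : Tor K) :
    (lapF K c m2)⁻¹ x y ≤ 2 / m2 * periodConst (kappaFree c m2 d) d * Real.exp (-(kappaFree c m2 d / (d + 1) * tdistT K x y)) :=
  le_trans (le_abs_self _) (abs_lapF_inv_le_exp_tdistT K hc hm x y)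

/-- the decay constant is non-negative. [folklore] -/
theorem periodConst_kappaFree_nonneg (hc : 0 ≤ c) (hm : 0 < m2) : 0 ≤ 2 / m2 * periodConst (kappaFree c m2 d) d := by
  have h := abs_lapF_inv_le_exp_tdistT (fun _ : Fin (d + 1) => 1) hc hm 0 0
  rw [tdistT_self, mul_zero, neg_zero, Real.exp_zero, mul_one] at h
  exact le_trans (abs_nonneg _) h

end TorusDecay

/-! ## §3 The free-boundary box covariance: part Ν-c's transport hypothesis discharged -/

section BoxDecay

variable (n : Fin (d + 1) → ℕ) [hn : ∀ μ, NeZero (n μ)] {c m2 : ℝ}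

/-- ★★★ **UNIFORM DECAY OF THE DOUBLED-TORUS IMAGE SUM**: `G^{Ω}(s,t) ≤ 2^{d+1}·(2∕m²)·periodConst κ_F d·e^{−(κ_F∕(d+1))·d_{T(2n)}(dbl s, dbl t)}` on every box — part Ν-c's
`kingBoxGreen_le_exp_of_torusDecay` with the torus hypothesis supplied by §2 (King p.670: «prove estimates on a lattice with periodic boundary conditions, and then carry over
the results to Ω» — here carried out for the free covariance with explicit constants). [cite: King1986, §4 p.670 l.8–13; Balaban1983RegularityDecay, (2.42) p.584] -/
theorem kingBoxGreen_le_exp (hc : 0 ≤ c) (hm : 0 < m2) (s t : KingBox n) :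
    kingBoxGreen n c m2 s t
      ≤ 2 ^ (d + 1) * (2 / m2 * periodConst (kappaFree c m2 d) d
          * Real.exp (-(kappaFree c m2 d / (d + 1) * tdistT (dblPer n) (dblBox n s) (dblBox n t)))) :=
  kingBoxGreen_le_exp_of_torusDecay n (periodConst_kappaFree_nonneg hc hm)
    (div_nonneg (kappaFree_pos hc hm d).le (by positivity)) (fun w w' => lapF_inv_le_exp_tdistT (dblPer n) hc hm w w') s t

/-- ★★★ **UNIFORM DECAY OF KING's FREE-BOUNDARY BOX COVARIANCE** `(c(−Δ_free) + m²)⁻¹` on every box `Π_μ{0,…,n_μ−1}`, explicit constants, both signs: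
`0 ≤ (boxOp n c m²)⁻¹(s,t) ≤ 2^{d+1}·(2∕m²)·periodConst κ_F d·e^{−(κ_F∕(d+1))·d_{T(2n)}(dbl s, dbl t)}`. [cite: King1986, §4 p.670 l.8–13, (2.13) p.653; Balaban1983RegularityDecay, (2.42) p.584] -/
theorem boxOp_inv_le_exp (hc : 0 ≤ c) (hm : 0 < m2) (s t : KingBox n) :
    0 ≤ (boxOp n c m2)⁻¹ s t ∧
      (boxOp n c m2)⁻¹ s t ≤ 2 ^ (d + 1) * (2 / m2 * periodConst (kappaFree c m2 d) d
          * Real.exp (-(kappaFree c m2 d / (d + 1) * tdistT (dblPer n) (dblBox n s) (dblBox n t)))) := by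
  rw [boxOp_inv_eq_kingBoxGreen n hc hm]
  exact ⟨kingBoxGreen_nonneg n hc hm s t, kingBoxGreen_le_exp n hc hm s t⟩

/-- ★★ **THE SAME BOUND FOR [Ba 4]'s IMAGE SERIES** of the free kernel at box points (Ε-c's `kingBoxGreen_eq_imK`). [cite: Balaban1983RegularityDecay, (2.42) p.584] -/
theorem imK_freeKer_le_exp (hc : 0 ≤ c) (hm : 0 < m2) (s t : KingBox n) :
    (box n (one_le_period n)).imK (fun u w => freeKer c m2 (u - w)) (kingBoxZ n s) (kingBoxZ n t)
      ≤ 2 ^ (d + 1) * (2 / m2 * periodConst (kappaFree c m2 d) d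
          * Real.exp (-(kappaFree c m2 d / (d + 1) * tdistT (dblPer n) (dblBox n s) (dblBox n t)))) := by
  rw [← kingBoxGreen_eq_imK n hc hm]
  exact kingBoxGreen_le_exp n hc hm s t

end BoxDecay

end Summit.QuantumFields.YangMills.BalabanUVNodes.N15KingModelRung.TorusSpectral

end
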